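import Literature.AlgebraicGeometry.Resolution.MonomialMarkedIdealsBlowupGeneral
import Literature.AlgebraicGeometry.Resolution.CartierDivisorControlledTransform
import HarnessLib

/-!
# Crux `PatchingRelPerfect` (stmt-ResolutionOfSingularities-16161), chain W5.2 — TargetsF5J (v5.1 08d1790a242ad669)
# E-side generic FEEDER, part 1 (scheme-generic): the MONOMIAL BOOKKEEPING of one weighted step with carried host
# and boundary exponents

[OURS · L1 W5.2 · TargetsF5J support · res-L1-w52-plan-1 g7 AMEND v5.1 + HANDS 2026-08-27T08:22:43Z «res-D-pv-021: the
E-side generic FEEDER … (iii) the MONOMIAL BOOKKEEPING lemma both sides need»; consumers res-D-pv-054 AS stub-6 (E-side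
invariant `𝔟_j = D_j · monomialIdeal ℬ_j` ⇒ `EndStateJ`'s identity) and res-D-pv-052 AS stub-7 (X-side analogue). Part 2
(`IsWeightedSeqJ.map_fst_eq`, `IsWeightedSeqJ.not_le_boundary` — items (i)/(ii) of the deal) is the sibling
`…DepthWeightedSeqJBookkeeping`, filed over the v5.1 `IsWeightedSeqJ` module once it is in the tree; THIS file does not
mention `IsWeightedSeqJ` and imports Literature only.]
Pure PROOFS over the tree's marked-monomial vocabulary (`Literature…MonomialMarkedIdeals[BlowupGeneral]`: `monomialIdeal`,
`boundaryOf`, `weightOf`, `divisorsOver`, `UniformPieces`, `exceptionalPiece`, `IsPiecePartition`) and the blow-up calculus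
(`controlledTransform`, `strictTransformIdeal`, `IsBlowup`); no definitions, no named facts, scheme-generic (so the SAME
lemmas serve the E-side step of `DepthTargets.IsWeightedSeqJ.cons` and the X-side step of `StepMixedJ`).

For a blowing up `τ : E'' → E'` along `C` (`IsBlowup τ C`, exceptional ideal `F = C𝒪_{E''} = C.comap τ`), a boundary with
exponents `ℬ : List (IdealSheafData E' × ℕ)` having simple normal crossings with the centre (`HasSNCWith (boundaryOf ℬ) C`)
and UNIFORM INCIDENCE with it on the single piece `V(C)` (`UniformPieces ℬ C [C.support]` — automatic for a connected
regular centre), write `w = weightOf ℬ (divisorsOver ℬ C C.support)` (the total exponent of the members CONTAINING the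
centre) and `ℬ.map st` for the strict transforms with the same exponents:

* `isPiecePartition_support_singleton` — `[V(C)]` is a piece partition of `V(C)`;
  `exceptionalPiece_support_eq_comap` — its exceptional piece `I(τ⁻¹V(C))` IS `F` (specialisation of the tree's
  `prod_exceptionalPiece_eq`);
* `comap_monomialIdeal_support` — **`τ^*(monomialIdeal ℬ) = F^w · monomialIdeal (ℬ.map st)`** and
  `controlledTransform_monomialIdeal_support` — **`τᶜ(monomialIdeal ℬ, k) = F^{w−k} · monomialIdeal (ℬ.map st)`** for
  `k ≤ w` (single-piece specialisations of `comap_monomialIdeal_pieces` / `controlledTransform_monomialIdeal_pieces`);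
* `comap_host_mul_monomialIdeal` — for a state `𝔟 = D · monomialIdeal ℬ` whose (reduced) host satisfies `D ≤ C^m`:
  **`τ^*𝔟 = F^{m+w} · (τᶜ(D, m) · monomialIdeal (ℬ.map st))`**;
* **`controlledTransform_host_mul_monomialIdeal` — THE BOOKKEEPING IDENTITY (iii)**: if moreover `ν ≤ m + w` (the
  ADMISSIBILITY SPLIT of `IsWeightedSeqJ.cons`), then
  `τᶜ(𝔟, ν) = τᶜ(D, m) · monomialIdeal (ℬ.map st ++ [(F, m + w − ν)])`
  — i.e. the new state is again «host × boundary monomial» with EXACTLY the exponent list that `IsWeightedSeqJ.cons`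
  books for the new exceptional member (host-side exponent `m + w − ν`); and the comap form
  `controlledTransform_host_mul_monomialIdeal'` with the new member written as a separate factor `F^{m+w−ν}`.

Proof: `τ^*` is multiplicative (`comap_mul`); `τ^*D = F^m · τᶜ(D, m)` (`IsBlowup.comap_eq_pow_mul_controlledTransform_of_le_pow`,
res-D-pv-026's brick (L-A) file); the monomial part by the pieces calculus with the single piece `V(C)`; then
`F^m · F^w = F^ν · F^{m+w−ν}` and the effective Cartier factor `F^ν` cancels in the colon
(`colon_pow_mul_eq`, `IsBlowup.isEffectiveCartier`). `E'` locally Noetherian (the pieces calculus reads stalks);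
`E''` is then locally Noetherian (`τ` proper, of finite type). AI-written; AI review is weaker than expert review. Nothing
here is a statement of the manuscript under review.

## References
* E. Bierstone, D. Grigoriev, P. Milman, J. Włodarczyk, *Effective Hironaka resolution and its complexity*, Asian J.
  Math. 15 (2011), Def. 3.1.3 (4), §3.2 Lemma 3.2.1, §4 Step 2a. [BierstoneGrigorievMilmanWlodarczyk2011]
* J. Kollár, *Lectures on Resolution of Singularities* (2007), (3.111) Steps 1–3. [Kollar2007]
-/

-- `Summit.<Summit>.<Sub>.Theorems` with `Sub = Summit` (single-conjunct summit, D-0017)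
set_option linter.dupNamespace false

noncomputable section

open CategoryTheory AlgebraicGeometry TopologicalSpace
open Literature.AlgebraicGeometry.Resolution
open Scheme.IdealSheafData

namespace Summit.ResolutionOfSingularities.ResolutionOfSingularities.Theorems.DepthTargets

universe u

variable {E' E'' : Scheme.{u}} {τ : E'' ⟶ E'} {C : E'.IdealSheafData} {ℬ : List (E'.IdealSheafData × ℕ)}

/-! ## The single piece `V(C)` -/

omit τ E'' in
/-- **`[V(C)]` is a piece partition of `V(C)`** (one piece: pairwise disjointness is empty, the union is `V(C)`).
[cite: BierstoneGrigorievMilmanWlodarczyk2011, §4 Step 2] -/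
theorem isPiecePartition_support_singleton (C : E'.IdealSheafData) : IsPiecePartition C [C.support] := by
  refine ⟨List.pairwise_singleton _ _, ?_⟩
  simp only [List.mem_singleton, Set.iUnion_iUnion_eq_left]

variable [IsLocallyNoetherian E']

/-- **The exceptional piece over the single piece `V(C)` is the exceptional divisor `F = C𝒪_{E''}`** (as ideal
sheaves: `I(τ⁻¹V(C)) = C.comap τ`), for a blowing up `τ` along a centre having simple normal crossings with the
boundary. [cite: BierstoneGrigorievMilmanWlodarczyk2011, §4 Step 2a] -/
theorem exceptionalPiece_support_eq_comap (hsnc : HasSNCWith (boundaryOf ℬ) C) (hτ : IsBlowup τ C) :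
    exceptionalPiece τ C.support = C.comap τ := by
  have h := prod_exceptionalPiece_eq hsnc hτ (isPiecePartition_support_singleton C)
  rwa [List.map_singleton, List.prod_singleton] at h

/-- **Total transform of the boundary monomial along a uniformly-incident snc centre**:
`τ^*(Π_k B_k^{c_k}) = F^w · Π_k (B_k')^{c_k}` with `w = weightOf ℬ (divisorsOver ℬ C V(C))` the total exponent of the
members containing the centre and `B_k'` the strict transforms (single-piece case of `comap_monomialIdeal_pieces`).
[cite: Kollar2007, (3.111) Step 1] [cite: BierstoneGrigorievMilmanWlodarczyk2011, §4 Step 2a] -/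
theorem comap_monomialIdeal_support (hsnc : HasSNCWith (boundaryOf ℬ) C) (hτ : IsBlowup τ C)
    (hU : UniformPieces ℬ C [C.support]) :
    (monomialIdeal ℬ).comap τ =
      C.comap τ ^ weightOf ℬ (divisorsOver ℬ C C.support) *
        monomialIdeal (ℬ.map fun p => (strictTransformIdeal τ C p.1, p.2)) := by
  have h := comap_monomialIdeal_pieces hsnc hτ (isPiecePartition_support_singleton C) hU
  rwa [List.map_singleton, List.prod_singleton, exceptionalPiece_support_eq_comap hsnc hτ] at h

/-- **Controlled transform of the boundary monomial with weight `k ≤ w`**: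
`τᶜ(Π_k B_k^{c_k}, k) = F^{w−k} · Π_k (B_k')^{c_k}` (single-piece case of `controlledTransform_monomialIdeal_pieces`).
[cite: Kollar2007, (3.111) Steps 1–3] [cite: BierstoneGrigorievMilmanWlodarczyk2011, §4 Step 2a] -/
theorem controlledTransform_monomialIdeal_support (hsnc : HasSNCWith (boundaryOf ℬ) C) (hτ : IsBlowup τ C)
    (hU : UniformPieces ℬ C [C.support]) {k : ℕ} (hk : k ≤ weightOf ℬ (divisorsOver ℬ C C.support)) :
    controlledTransform τ C (monomialIdeal ℬ) k =
      C.comap τ ^ (weightOf ℬ (divisorsOver ℬ C C.support) - k) *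
        monomialIdeal (ℬ.map fun p => (strictTransformIdeal τ C p.1, p.2)) := by
  have h := controlledTransform_monomialIdeal_pieces hsnc hτ (isPiecePartition_support_singleton C) hU
    (k := k) (fun Z hZ => by rw [List.mem_singleton.mp hZ]; exact hk)
  rwa [List.map_singleton, List.prod_singleton, exceptionalPiece_support_eq_comap hsnc hτ] at h

/-! ## The state «host × boundary monomial» under one weighted step -/

/-- **Total transform of a state `𝔟 = D · monomialIdeal ℬ` with host order `m` along the centre** (`D ≤ C^m`):
`τ^*𝔟 = F^{m+w} · (τᶜ(D, m) · monomialIdeal (ℬ.map st))`. [cite: BierstoneGrigorievMilmanWlodarczyk2011, §3.2 Lemma 3.2.1, §4 Step 2a] -/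
theorem comap_host_mul_monomialIdeal {𝔟 D : E'.IdealSheafData} {m : ℕ} (h𝔟 : 𝔟 = D * monomialIdeal ℬ)
    (hD : D ≤ C ^ m) (hsnc : HasSNCWith (boundaryOf ℬ) C) (hU : UniformPieces ℬ C [C.support])
    (hτ : IsBlowup τ C) :
    𝔟.comap τ =
      C.comap τ ^ (m + weightOf ℬ (divisorsOver ℬ C C.support)) *
        (controlledTransform τ C D m * monomialIdeal (ℬ.map fun p => (strictTransformIdeal τ C p.1, p.2))) := by
  rw [h𝔟, comap_mul, hτ.comap_eq_pow_mul_controlledTransform_of_le_pow hD,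
    comap_monomialIdeal_support hsnc hτ hU, pow_add]
  ring

/-- **THE MONOMIAL BOOKKEEPING IDENTITY (iii) of one `IsWeightedSeqJ.cons` step.** For a state `𝔟 = D · monomialIdeal ℬ`
on `E'` (carried host `D` times the boundary monomial with exponents), a blowing up `τ` along `C` with `IsBlowup τ C`,
host order `m` (`D ≤ C^m`), boundary snc and uniformly incident with the centre, `w` = the total exponent of the members
containing the centre, and a weight `ν` with the ADMISSIBILITY SPLIT `ν ≤ m + w`:
`τᶜ(𝔟, ν) = τᶜ(D, m) · monomialIdeal (ℬ.map (st × id) ++ [(F, m + w − ν)])` —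
the weight-`ν` controlled transform of the state is the weight-`m` controlled transform of the host times the boundary
monomial of EXACTLY the exponent list booked by `DepthTargets.IsWeightedSeqJ.cons` (strict transforms with their
exponents, then the exceptional divisor `F = C𝒪_{E''}` with host-side exponent `m + w − ν`). No hypothesis `𝔟 ≤ C^ν` is
needed (it FOLLOWS: `τ^*𝔟 ∈ F^{m+w} ⊆ F^ν`). [cite: BierstoneGrigorievMilmanWlodarczyk2011, Def. 3.1.3 (4), §3.2 Lemma 3.2.1, §4 Step 2a]
[cite: Kollar2007, (3.111) Steps 1–3] -/
theorem controlledTransform_host_mul_monomialIdeal {𝔟 D : E'.IdealSheafData} {m ν : ℕ}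
    (h𝔟 : 𝔟 = D * monomialIdeal ℬ) (hD : D ≤ C ^ m)
    (hν : ν ≤ m + weightOf ℬ (divisorsOver ℬ C C.support))
    (hsnc : HasSNCWith (boundaryOf ℬ) C) (hU : UniformPieces ℬ C [C.support]) (hτ : IsBlowup τ C) :
    controlledTransform τ C 𝔟 ν =
      controlledTransform τ C D m *
        monomialIdeal ((ℬ.map fun p => (strictTransformIdeal τ C p.1, p.2)) ++
          [(C.comap τ, m + weightOf ℬ (divisorsOver ℬ C C.support) - ν)]) := by
  haveI : IsProper τ := hτ.isProper
  haveI : IsLocallyNoetherian E'' := LocallyOfFiniteType.isLocallyNoetherian τ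
  set w := weightOf ℬ (divisorsOver ℬ C C.support) with hw
  -- `τ^*𝔟 = F^ν · (F^{m+w-ν} · τᶜ(D,m) · M')`
  have hsplit : 𝔟.comap τ = C.comap τ ^ ν * (C.comap τ ^ (m + w - ν) *
      (controlledTransform τ C D m * monomialIdeal (ℬ.map fun p => (strictTransformIdeal τ C p.1, p.2)))) := by
    rw [comap_host_mul_monomialIdeal h𝔟 hD hsnc hU hτ, ← hw, ← mul_assoc (C.comap τ ^ ν), ← pow_add,
      Nat.add_sub_cancel' hν]
  rw [controlledTransform, hsplit, colon_pow_mul_eq hτ.isEffectiveCartier, monomialIdeal_append,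
    monomialIdeal_singleton]
  ring

/-- The same identity with the new exceptional member as a separate factor:
`τᶜ(𝔟, ν) = F^{m+w−ν} · (τᶜ(D, m) · monomialIdeal (ℬ.map st))`. [cite: Kollar2007, (3.111) Steps 1–3] -/
theorem controlledTransform_host_mul_monomialIdeal' {𝔟 D : E'.IdealSheafData} {m ν : ℕ}
    (h𝔟 : 𝔟 = D * monomialIdeal ℬ) (hD : D ≤ C ^ m)
    (hν : ν ≤ m + weightOf ℬ (divisorsOver ℬ C C.support))
    (hsnc : HasSNCWith (boundaryOf ℬ) C) (hU : UniformPieces ℬ C [C.support]) (hτ : IsBlowup τ C) :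
    controlledTransform τ C 𝔟 ν =
      C.comap τ ^ (m + weightOf ℬ (divisorsOver ℬ C C.support) - ν) *
        (controlledTransform τ C D m * monomialIdeal (ℬ.map fun p => (strictTransformIdeal τ C p.1, p.2))) := by
  rw [controlledTransform_host_mul_monomialIdeal h𝔟 hD hν hsnc hU hτ, monomialIdeal_append, monomialIdeal_singleton]
  ring

/-- **The state is weight-`ν` permissible along the centre after pull-back**: `τ^*𝔟 ≤ F^ν` (from `ν ≤ m + w`; the
form in which `IsBlowup.pow_mul_controlledTransform_eq` consumes it). [cite: BierstoneGrigorievMilmanWlodarczyk2011, §3.2 Lemma 3.2.1] -/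
theorem comap_host_mul_monomialIdeal_le_pow {𝔟 D : E'.IdealSheafData} {m ν : ℕ}
    (h𝔟 : 𝔟 = D * monomialIdeal ℬ) (hD : D ≤ C ^ m)
    (hν : ν ≤ m + weightOf ℬ (divisorsOver ℬ C C.support))
    (hsnc : HasSNCWith (boundaryOf ℬ) C) (hU : UniformPieces ℬ C [C.support]) (hτ : IsBlowup τ C) :
    𝔟.comap τ ≤ C.comap τ ^ ν := by
  rw [comap_host_mul_monomialIdeal h𝔟 hD hsnc hU hτ, ← Nat.add_sub_cancel' hν, pow_add, mul_assoc]
  exact mul_le_of_le_one_right bot_le le_top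

/-- **Format of the new state**: `τ^*𝔟 = F^ν · τᶜ(𝔟, ν)` with `τᶜ(𝔟, ν)` as in the bookkeeping identity (the
`IsBlowup.pow_mul_controlledTransform_eq` form, for consumers that read the step as «total = exceptional^ν × new state»).
[cite: BierstoneGrigorievMilmanWlodarczyk2011, §3.2 Lemma 3.2.1] -/
theorem comap_eq_pow_mul_controlledTransform_host_mul_monomialIdeal {𝔟 D : E'.IdealSheafData} {m ν : ℕ}
    (h𝔟 : 𝔟 = D * monomialIdeal ℬ) (hD : D ≤ C ^ m)
    (hν : ν ≤ m + weightOf ℬ (divisorsOver ℬ C C.support))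
    (hsnc : HasSNCWith (boundaryOf ℬ) C) (hU : UniformPieces ℬ C [C.support]) (hτ : IsBlowup τ C) :
    𝔟.comap τ = C.comap τ ^ ν * controlledTransform τ C 𝔟 ν :=
  (hτ.pow_mul_controlledTransform_eq (comap_host_mul_monomialIdeal_le_pow h𝔟 hD hν hsnc hU hτ)).symm

/-! ## The N-side (contact-monomial) exponent list (APPEND rev 2)

The second exponent list `𝒟` of `IsWeightedSeqJR` books the exponents of the X-side contact monomial `N` with the law
`𝒟'' = 𝒟'.map (st × id) ++ [(F, w_𝒟 + (μ − ν))]`, matching `N' = σ^*N · 𝓘(exc)^{μ−ν}` (a TOTAL transform times extra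
copies of the exceptional divisor, no colon). -/

/-- **N-side bookkeeping**: `τ^*(monomialIdeal 𝒟) · F^k = monomialIdeal (𝒟.map (st × id) ++ [(F, w_𝒟 + k)])` with
`w_𝒟 = weightOf 𝒟 (divisorsOver 𝒟 C V(C))` — for `k = μ − ν` exactly the `𝒟`-list booked by `DepthTargets.IsWeightedSeqJR.cons`
(X-side law `N' = σ^*N · 𝓘(exc)^{μ−ν}` of `StepMixedJR`). [cite: BierstoneGrigorievMilmanWlodarczyk2011, §4 Step 2a]
[cite: Kollar2007, (3.111) Step 1] -/
theorem comap_monomialIdeal_mul_pow_eq_monomialIdeal_append {𝒟 : List (E'.IdealSheafData × ℕ)}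
    (hsnc : HasSNCWith (boundaryOf 𝒟) C) (hτ : IsBlowup τ C) (hU : UniformPieces 𝒟 C [C.support]) (k : ℕ) :
    (monomialIdeal 𝒟).comap τ * C.comap τ ^ k =
      monomialIdeal ((𝒟.map fun p => (strictTransformIdeal τ C p.1, p.2)) ++
        [(C.comap τ, weightOf 𝒟 (divisorsOver 𝒟 C C.support) + k)]) := by
  rw [comap_monomialIdeal_support hsnc hτ hU, monomialIdeal_append, monomialIdeal_singleton, pow_add]
  ring

/-- The same with no extra copies: `τ^*(monomialIdeal 𝒟) = monomialIdeal (𝒟.map (st × id) ++ [(F, w_𝒟)])` (the total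
transform of a boundary monomial is the monomial of the transformed exponent list). [cite: Kollar2007, (3.111) Step 1] -/
theorem comap_monomialIdeal_eq_monomialIdeal_append {𝒟 : List (E'.IdealSheafData × ℕ)}
    (hsnc : HasSNCWith (boundaryOf 𝒟) C) (hτ : IsBlowup τ C) (hU : UniformPieces 𝒟 C [C.support]) :
    (monomialIdeal 𝒟).comap τ =
      monomialIdeal ((𝒟.map fun p => (strictTransformIdeal τ C p.1, p.2)) ++
        [(C.comap τ, weightOf 𝒟 (divisorsOver 𝒟 C C.support))]) := by
  rw [comap_monomialIdeal_support hsnc hτ hU, monomialIdeal_append, monomialIdeal_singleton]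
  ring

omit [IsLocallyNoetherian E'] in
/-- `HasSNCWith (boundaryOf ·) C` only depends on the underlying boundary: transfer along `boundaryOf 𝒟 = boundaryOf ℬ`
(the two lists of `IsWeightedSeqJR` share their boundary, `IsWeightedSeqJR.map_fst_eq`). [folklore] -/
theorem hasSNCWith_boundaryOf_of_eq {𝒟 : List (E'.IdealSheafData × ℕ)} (h : boundaryOf 𝒟 = boundaryOf ℬ)
    (hsnc : HasSNCWith (boundaryOf ℬ) C) : HasSNCWith (boundaryOf 𝒟) C := by
  rw [h]; exact hsnc

omit [IsLocallyNoetherian E'] in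
/-- `UniformPieces · C Zs` only depends on the underlying boundary: transfer along `boundaryOf 𝒟 = boundaryOf ℬ`. [folklore] -/
theorem uniformPieces_of_boundaryOf_eq {𝒟 : List (E'.IdealSheafData × ℕ)} {Zs : List (Closeds E')}
    (h : boundaryOf 𝒟 = boundaryOf ℬ) (hU : UniformPieces ℬ C Zs) : UniformPieces 𝒟 C Zs := by
  intro Z hZ K hK
  rw [h] at hK
  exact hU Z hZ K hK

/-! ## States that are SUMS (X-side shape `K = 𝓐 · mono ⊔ N · 𝓘_E^ℓ`) -/

omit [IsLocallyNoetherian E'] in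
/-- **Controlled transform of a sum of two factored states**: if `σ^*A = F^ν · A'` and `σ^*B = F^ν · B'` for the exceptional
divisor `F = C𝒪` of a blowing up `σ` along `C` (effective Cartier), then `σᶜ(A ⊔ B, ν) = A' ⊔ B'` — pull-back preserves sums
(`comap_sup`), `F^ν` distributes and cancels in the colon.  The X-side state of `StepMixedJR` is such a sum (host × boundary
monomial ⊔ contact monomial × `𝓘_E^ℓ`); each summand is factored by `comap_host_mul_monomialIdeal` /
`comap_monomialIdeal_mul_pow_eq_monomialIdeal_append`. [cite: BierstoneGrigorievMilmanWlodarczyk2011, §3.2 Lemma 3.2.1] -/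
theorem controlledTransform_sup_of_comap_eq [IsLocallyNoetherian E''] {A B : E'.IdealSheafData}
    {A' B' : E''.IdealSheafData} {ν : ℕ} (hF : IsEffectiveCartier (C.comap τ))
    (hA : A.comap τ = C.comap τ ^ ν * A') (hB : B.comap τ = C.comap τ ^ ν * B') :
    controlledTransform τ C (A ⊔ B) ν = A' ⊔ B' := by
  rw [controlledTransform, Scheme.IdealSheafData.comap_sup, hA, hB, ← Scheme.IdealSheafData.mul_inf]
  exact colon_pow_mul_eq hF _ ν

/-- The same for a blowing up (`IsBlowup τ C`: the exceptional ideal is effective Cartier, and `E''` is locally Noetherian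
over a locally Noetherian `E'`). [cite: BierstoneGrigorievMilmanWlodarczyk2011, §3.2 Lemma 3.2.1] -/
theorem controlledTransform_sup_of_comap_eq_of_isBlowup {A B : E'.IdealSheafData} {A' B' : E''.IdealSheafData} {ν : ℕ}
    (hτ : IsBlowup τ C) (hA : A.comap τ = C.comap τ ^ ν * A') (hB : B.comap τ = C.comap τ ^ ν * B') :
    controlledTransform τ C (A ⊔ B) ν = A' ⊔ B' := by
  haveI : IsProper τ := hτ.isProper
  haveI : IsLocallyNoetherian E'' := LocallyOfFiniteType.isLocallyNoetherian τ
  exact controlledTransform_sup_of_comap_eq hτ.isEffectiveCartier hA hB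

end Summit.ResolutionOfSingularities.ResolutionOfSingularities.Theorems.DepthTargets

end
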